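import Summits.Ventures.CertifiedManyBodySolver.Observables.SourcedGibbsTrialCapKSpace
import Literature.Probability.LatticeModels.LipschitzRiemannSum
import HarnessLib

/-!
# The HF–BCS sourced cap in momentum space (V): Lipschitz constants of the BdG energy integrand and the
# uniform-in-`L` Riemann bound for the energy sum

HONEST FRAMING: zero compute; proved real-analysis lemmas towards the `∃ L₀ ∀ L ≥ L₀` (uniform-in-`L`) packaging of
the certified HF–BCS cap (`groundEnergy_dWaveSourceTorus_le_HFBCS_kSpace'`): the momentum sum `Σ_k E_k tanh(βE_k/2)`
is a Riemann sum of a `2π`-periodic integrand which is Lipschitz in each variable with the `β`-FREE constant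
`K₁ = (3/2)(2 + 2√2|h|)`, so `LipschitzRiemannSum.abs_sum_torusSite_two_sub_integral_le` prices it against its
Brillouin-zone integral with error `2πK₁L`, and two grids `L, L'` differ by `≤ 2πK₁(1/L + 1/L')` per site. The density
integrand `1 − ξ_k tanh(βE_k/2)/E_k` (Lipschitz constant `∝ β`) and the assembled uniform row are successor work.
No number is claimed; not a statement about order; not a superconductivity verdict.

* `abs_mul_tanh_sub_mul_tanh_le` — `u ↦ u·tanh(βu/2)` is `3/2`-Lipschitz on `ℝ` (`|tanh| ≤ 1`, `|w| sech² w ≤ 1/2`);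
* `abs_bdgEnergy_sub_le_fst/snd` — `E(x,y) = √(ξ² + g²)`, `ξ = −2(cos x + cos y) − μ'`, `g = 2√2h(cos x − cos y)`, is
  `(2 + 2√2|h|)`-Lipschitz in each variable;
* `abs_sum_bdgEnergyTanh_sub_integral_le` — the Davis–Rabinowitz bound for `Σ_k E_k tanh(βE_k/2)`;
* `abs_bdgEnergyTanh_density_two_grid_le` — `|S_L/L² − S_{L'}/L'²| ≤ 2πK₁(1/L + 1/L')`.

References: Davis–Rabinowitz, *Methods of Numerical Integration* (1984) §2.1 (2.1.6) [DavisRabinowitz1984];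
von Delft–Ralph, Phys. Rep. 345 (2001) 61, §4.2 [VondelftRalph2001].
-/

noncomputable section

open Real Finset Literature.MathematicalPhysics.QuantumLattice Literature.Probability.LatticeModels

namespace Summit.Ventures.CertifiedManyBodySolver.Observables

/-! ### §1 `u ↦ u·tanh(βu/2)` is `3/2`-Lipschitz -/

/-- `|w| / cosh² w ≤ 1/2` (from `|w| ≤ |sinh w|` and `2|w| ≤ 1 + w²`). [folklore] -/
theorem abs_div_cosh_sq_le_half (w : ℝ) : |w| / Real.cosh w ^ 2 ≤ 1 / 2 := by
  have hc : 0 < Real.cosh w ^ 2 := by positivity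
  have h1 : |w| ≤ |Real.sinh w| := by
    rw [Real.abs_sinh]
    exact Real.self_le_sinh_iff.2 (abs_nonneg w)
  have h2 : w ^ 2 ≤ Real.sinh w ^ 2 := by
    have := sq_le_sq' (by linarith [abs_nonneg w, neg_abs_le w, h1, abs_nonneg (Real.sinh w)]) h1
    simpa [sq_abs] using (sq_le_sq.2 (by simpa using h1))
  have h3 : 2 * |w| ≤ 1 + w ^ 2 := by nlinarith [sq_nonneg (|w| - 1), sq_abs w]
  rw [div_le_div_iff₀ hc (by norm_num : (0 : ℝ) < 2), Real.cosh_sq']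
  nlinarith

/-- The derivative of `u ↦ u·tanh(βu/2)`: `tanh(βu/2) + (βu/2)/cosh²(βu/2)`. [folklore] -/
theorem hasDerivAt_mul_tanh (β u : ℝ) :
    HasDerivAt (fun v : ℝ => v * Real.tanh (β * v / 2))
      (Real.tanh (β * u / 2) + (β * u / 2) / Real.cosh (β * u / 2) ^ 2) u := by
  have hlin : HasDerivAt (fun v : ℝ => β * v / 2) (β / 2) u := by
    have := ((hasDerivAt_id u).const_mul β).div_const 2
    simpa using this
  have hs : HasDerivAt (fun v : ℝ => Real.sinh (β * v / 2)) (Real.cosh (β * u / 2) * (β / 2)) u :=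
    (Real.hasDerivAt_sinh _).comp u hlin
  have hc : HasDerivAt (fun v : ℝ => Real.cosh (β * v / 2)) (Real.sinh (β * u / 2) * (β / 2)) u :=
    (Real.hasDerivAt_cosh _).comp u hlin
  have hne : Real.cosh (β * u / 2) ≠ 0 := (Real.cosh_pos _).ne'
  have hq := hs.div hc hne
  have hφ := (hasDerivAt_id u).mul hq
  have hφ' : HasDerivAt (fun v : ℝ => v * Real.tanh (β * v / 2))
      (1 * ((fun v : ℝ => Real.sinh (β * v / 2)) / fun v : ℝ => Real.cosh (β * v / 2)) u +
        id u * ((Real.cosh (β * u / 2) * (β / 2) * Real.cosh (β * u / 2) -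
          Real.sinh (β * u / 2) * (Real.sinh (β * u / 2) * (β / 2))) / Real.cosh (β * u / 2) ^ 2)) u :=
    hφ.congr_of_eventuallyEq (Filter.Eventually.of_forall fun v => by
      simp only [Pi.mul_apply, Pi.div_apply, id, Real.tanh_eq_sinh_div_cosh])
  refine hφ'.congr_deriv ?_
  have h1 : Real.cosh (β * u / 2) * (β / 2) * Real.cosh (β * u / 2) -
      Real.sinh (β * u / 2) * (Real.sinh (β * u / 2) * (β / 2)) = β / 2 := by
    have := Real.cosh_sq_sub_sinh_sq (β * u / 2)
    linear_combination (β / 2) * this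
  simp only [Pi.div_apply, id, h1]
  rw [Real.tanh_eq_sinh_div_cosh]
  ring

/-- **`u ↦ u·tanh(βu/2)` is `3/2`-Lipschitz**: `|u tanh(βu/2) − v tanh(βv/2)| ≤ (3/2)|u − v|`
(`|tanh| ≤ 1`, `|w|/cosh² w ≤ 1/2`). [folklore] -/
theorem abs_mul_tanh_sub_mul_tanh_le (β u v : ℝ) :
    |u * Real.tanh (β * u / 2) - v * Real.tanh (β * v / 2)| ≤ 3 / 2 * |u - v| := by
  have hdiff : Differentiable ℝ (fun v : ℝ => v * Real.tanh (β * v / 2)) :=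
    fun w => (hasDerivAt_mul_tanh β w).differentiableAt
  have hbound : ∀ w : ℝ, ‖deriv (fun v : ℝ => v * Real.tanh (β * v / 2)) w‖₊ ≤ (⟨3 / 2, by norm_num⟩ : NNReal) := by
    intro w
    rw [(hasDerivAt_mul_tanh β w).deriv]
    have h1 : |Real.tanh (β * w / 2)| ≤ 1 := (Real.abs_tanh_lt_one _).le
    have h2 : |β * w / 2 / Real.cosh (β * w / 2) ^ 2| ≤ 1 / 2 := by
      rw [abs_div, abs_of_pos (by positivity : (0 : ℝ) < Real.cosh (β * w / 2) ^ 2)]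
      exact abs_div_cosh_sq_le_half _
    have h3 := (abs_add_le _ _).trans (add_le_add h1 h2)
    rw [← NNReal.coe_le_coe, coe_nnnorm, Real.norm_eq_abs]
    norm_num at h3 ⊢
    exact h3
  have hlip := lipschitzWith_of_nnnorm_deriv_le hdiff hbound
  have := hlip.dist_le_mul u v
  rw [Real.dist_eq, Real.dist_eq] at this
  norm_num at this
  exact this

/-! ### §2 The BdG energy `E(x,y)` is Lipschitz in each momentum component -/

/-- `|√(a² + b²) − √(a'² + b'²)| ≤ |a − a'| + |b − b'|` (reverse triangle inequality for the Euclidean norm,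
via `‖a + bI‖ = √(a² + b²)`). [folklore] -/
theorem abs_sqrt_sq_add_sq_sub_le (a b a' b' : ℝ) :
    |Real.sqrt (a ^ 2 + b ^ 2) - Real.sqrt (a' ^ 2 + b' ^ 2)| ≤ |a - a'| + |b - b'| := by
  rw [← Complex.norm_add_mul_I a b, ← Complex.norm_add_mul_I a' b']
  refine (abs_norm_sub_norm_le _ _).trans ?_
  have hsub : ((a : ℂ) + b * Complex.I) - ((a' : ℂ) + b' * Complex.I) =
      ((a - a' : ℝ) : ℂ) + ((b - b' : ℝ) : ℂ) * Complex.I := by push_cast; ring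
  rw [hsub]
  refine (norm_add_le _ _).trans ?_
  rw [norm_mul, Complex.norm_I, mul_one, Complex.norm_real, Complex.norm_real, Real.norm_eq_abs, Real.norm_eq_abs]

/-- **The BdG quasi-particle energy is Lipschitz in the first momentum**: with `ξ = −2(cos x + cos y) − μ'`,
`g = 2√2h(cos x − cos y)`, `E = √(ξ² + g²)`: `|E(x,y) − E(x',y)| ≤ (2 + 2√2|h|)|x − x'|`. [cite: VondelftRalph2001, §4.2] -/
theorem abs_bdgEnergy_sub_le_fst (μ' h x x' y : ℝ) :
    |Real.sqrt ((-2 * (Real.cos x + Real.cos y) - μ') ^ 2 + (2 * Real.sqrt 2 * h * (Real.cos x - Real.cos y)) ^ 2) -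
      Real.sqrt ((-2 * (Real.cos x' + Real.cos y) - μ') ^ 2 + (2 * Real.sqrt 2 * h * (Real.cos x' - Real.cos y)) ^ 2)| ≤
      (2 + 2 * Real.sqrt 2 * |h|) * |x - x'| := by
  refine (abs_sqrt_sq_add_sq_sub_le _ _ _ _).trans ?_
  have hcos := Real.abs_cos_sub_cos_le x x'
  have e1 : (-2 * (Real.cos x + Real.cos y) - μ') - (-2 * (Real.cos x' + Real.cos y) - μ') =
      -2 * (Real.cos x - Real.cos x') := by ring
  have e2 : 2 * Real.sqrt 2 * h * (Real.cos x - Real.cos y) - 2 * Real.sqrt 2 * h * (Real.cos x' - Real.cos y) =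
      (2 * Real.sqrt 2 * h) * (Real.cos x - Real.cos x') := by ring
  rw [e1, e2]
  simp only [abs_mul, abs_neg, abs_two, abs_of_nonneg (Real.sqrt_nonneg 2)]
  have hnn : 0 ≤ 2 * Real.sqrt 2 * |h| := by positivity
  nlinarith [hcos, hnn, abs_nonneg (Real.cos x - Real.cos x')]

/-- **The BdG quasi-particle energy is Lipschitz in the second momentum**: `|E(x,y) − E(x,y')| ≤ (2 + 2√2|h|)|y − y'|`.
[cite: VondelftRalph2001, §4.2] -/
theorem abs_bdgEnergy_sub_le_snd (μ' h x y y' : ℝ) :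
    |Real.sqrt ((-2 * (Real.cos x + Real.cos y) - μ') ^ 2 + (2 * Real.sqrt 2 * h * (Real.cos x - Real.cos y)) ^ 2) -
      Real.sqrt ((-2 * (Real.cos x + Real.cos y') - μ') ^ 2 + (2 * Real.sqrt 2 * h * (Real.cos x - Real.cos y')) ^ 2)| ≤
      (2 + 2 * Real.sqrt 2 * |h|) * |y - y'| := by
  refine (abs_sqrt_sq_add_sq_sub_le _ _ _ _).trans ?_
  have hcos := Real.abs_cos_sub_cos_le y y'
  have e1 : (-2 * (Real.cos x + Real.cos y) - μ') - (-2 * (Real.cos x + Real.cos y') - μ') =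
      -2 * (Real.cos y - Real.cos y') := by ring
  have e2 : 2 * Real.sqrt 2 * h * (Real.cos x - Real.cos y) - 2 * Real.sqrt 2 * h * (Real.cos x - Real.cos y') =
      -(2 * Real.sqrt 2 * h) * (Real.cos y - Real.cos y') := by ring
  rw [e1, e2]
  simp only [abs_mul, abs_neg, abs_two, abs_of_nonneg (Real.sqrt_nonneg 2)]
  have hnn : 0 ≤ 2 * Real.sqrt 2 * |h| := by positivity
  nlinarith [hcos, hnn, abs_nonneg (Real.cos y - Real.cos y')]

/-! ### §3 The energy integrand `E·tanh(βE/2)`: periodicity, Lipschitz constants, Riemann bound -/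

/-- **The energy integrand is `K₁`-Lipschitz in the first momentum**, `K₁ = (3/2)(2 + 2√2|h|)` (`β`-free).
[cite: DavisRabinowitz1984, §2.1 eq. (2.1.6)] -/
theorem abs_bdgEnergyTanh_sub_le_fst (β μ' h x x' y : ℝ) :
    |Real.sqrt ((-2 * (Real.cos x + Real.cos y) - μ') ^ 2 + (2 * Real.sqrt 2 * h * (Real.cos x - Real.cos y)) ^ 2) *
        Real.tanh (β * Real.sqrt ((-2 * (Real.cos x + Real.cos y) - μ') ^ 2 +
          (2 * Real.sqrt 2 * h * (Real.cos x - Real.cos y)) ^ 2) / 2) -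
      Real.sqrt ((-2 * (Real.cos x' + Real.cos y) - μ') ^ 2 + (2 * Real.sqrt 2 * h * (Real.cos x' - Real.cos y)) ^ 2) *
        Real.tanh (β * Real.sqrt ((-2 * (Real.cos x' + Real.cos y) - μ') ^ 2 +
          (2 * Real.sqrt 2 * h * (Real.cos x' - Real.cos y)) ^ 2) / 2)| ≤
      3 / 2 * (2 + 2 * Real.sqrt 2 * |h|) * |x - x'| := by
  refine (abs_mul_tanh_sub_mul_tanh_le β _ _).trans ?_
  have hE := mul_le_mul_of_nonneg_left (abs_bdgEnergy_sub_le_fst μ' h x x' y) (by norm_num : (0 : ℝ) ≤ 3 / 2)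
  linarith [hE]

/-- **The energy integrand is `K₁`-Lipschitz in the second momentum.** [cite: DavisRabinowitz1984, §2.1 eq. (2.1.6)] -/
theorem abs_bdgEnergyTanh_sub_le_snd (β μ' h x y y' : ℝ) :
    |Real.sqrt ((-2 * (Real.cos x + Real.cos y) - μ') ^ 2 + (2 * Real.sqrt 2 * h * (Real.cos x - Real.cos y)) ^ 2) *
        Real.tanh (β * Real.sqrt ((-2 * (Real.cos x + Real.cos y) - μ') ^ 2 +
          (2 * Real.sqrt 2 * h * (Real.cos x - Real.cos y)) ^ 2) / 2) -
      Real.sqrt ((-2 * (Real.cos x + Real.cos y') - μ') ^ 2 + (2 * Real.sqrt 2 * h * (Real.cos x - Real.cos y')) ^ 2) *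
        Real.tanh (β * Real.sqrt ((-2 * (Real.cos x + Real.cos y') - μ') ^ 2 +
          (2 * Real.sqrt 2 * h * (Real.cos x - Real.cos y')) ^ 2) / 2)| ≤
      3 / 2 * (2 + 2 * Real.sqrt 2 * |h|) * |y - y'| := by
  refine (abs_mul_tanh_sub_mul_tanh_le β _ _).trans ?_
  have hE := mul_le_mul_of_nonneg_left (abs_bdgEnergy_sub_le_snd μ' h x y y') (by norm_num : (0 : ℝ) ≤ 3 / 2)
  linarith [hE]

/-- **Davis–Rabinowitz bound for the BdG energy sum** (every `L ≥ 1`, every `β, μ', h`):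
`|Σ_k E_k tanh(βE_k/2) − L²/(4π²) ∫∫ E tanh(βE/2)| ≤ 2π·(3/2)(2 + 2√2|h|)·L`, where in the sum
`E_k = √((torusBand L k − μ')² + (2√2 h ĝ_d(k))²)`. [cite: DavisRabinowitz1984, §2.1 eq. (2.1.6)] -/
theorem abs_sum_bdgEnergyTanh_sub_integral_le (L : ℕ) [NeZero L] (β μ' h : ℝ) :
    |(∑ k : TorusSite 2 L,
        Real.sqrt ((torusBand L k - μ') ^ 2 + (2 * Real.sqrt 2 * h * dWaveGap k) ^ 2) *
          Real.tanh (β * Real.sqrt ((torusBand L k - μ') ^ 2 + (2 * Real.sqrt 2 * h * dWaveGap k) ^ 2) / 2)) -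
      (L : ℝ) ^ 2 / (4 * π ^ 2) * ∫ y in (-π)..π, ∫ x in (-π)..π,
        Real.sqrt ((-2 * (Real.cos x + Real.cos y) - μ') ^ 2 + (2 * Real.sqrt 2 * h * (Real.cos x - Real.cos y)) ^ 2) *
          Real.tanh (β * Real.sqrt ((-2 * (Real.cos x + Real.cos y) - μ') ^ 2 +
            (2 * Real.sqrt 2 * h * (Real.cos x - Real.cos y)) ^ 2) / 2)| ≤
      2 * π * (3 / 2 * (2 + 2 * Real.sqrt 2 * |h|)) * L := by
  have hK : (0 : ℝ) ≤ 3 / 2 * (2 + 2 * Real.sqrt 2 * |h|) := by positivity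
  have key := abs_sum_torusSite_two_sub_integral_le
    (f := fun x y => Real.sqrt ((-2 * (Real.cos x + Real.cos y) - μ') ^ 2 +
        (2 * Real.sqrt 2 * h * (Real.cos x - Real.cos y)) ^ 2) *
      Real.tanh (β * Real.sqrt ((-2 * (Real.cos x + Real.cos y) - μ') ^ 2 +
        (2 * Real.sqrt 2 * h * (Real.cos x - Real.cos y)) ^ 2) / 2)) hK
    (fun y x => by simp only [Real.cos_add_two_pi])
    (fun x y => by simp only [Real.cos_add_two_pi])
    (fun x x' y => abs_bdgEnergyTanh_sub_le_fst β μ' h x x' y)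
    (fun x y y' => abs_bdgEnergyTanh_sub_le_snd β μ' h x y y') L
  have hsum : ∀ k : TorusSite 2 L,
      Real.sqrt ((torusBand L k - μ') ^ 2 + (2 * Real.sqrt 2 * h * dWaveGap k) ^ 2) *
          Real.tanh (β * Real.sqrt ((torusBand L k - μ') ^ 2 + (2 * Real.sqrt 2 * h * dWaveGap k) ^ 2) / 2) =
        Real.sqrt ((-2 * (Real.cos (latticeMomentum L k 0) + Real.cos (latticeMomentum L k 1)) - μ') ^ 2 +
            (2 * Real.sqrt 2 * h * (Real.cos (latticeMomentum L k 0) - Real.cos (latticeMomentum L k 1))) ^ 2) *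
          Real.tanh (β * Real.sqrt ((-2 * (Real.cos (latticeMomentum L k 0) + Real.cos (latticeMomentum L k 1)) - μ') ^ 2 +
            (2 * Real.sqrt 2 * h * (Real.cos (latticeMomentum L k 0) - Real.cos (latticeMomentum L k 1))) ^ 2) / 2) := by
    intro k
    simp only [torusBand, dWaveGap, Fin.sum_univ_two]
  rw [Finset.sum_congr rfl fun k _ => hsum k]
  exact key

/-- **Two momentum grids differ by `O(1/L + 1/L')` per site** for the BdG energy sum:
`|S_L/L² − S_{L'}/L'²| ≤ 2π·K₁·(1/L + 1/L')`, `K₁ = (3/2)(2 + 2√2|h|)` — the uniform-in-`L` control the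
`∃ L₀ ∀ L ≥ L₀` cap packaging consumes for its energy term. [cite: DavisRabinowitz1984, §2.1 eq. (2.1.6)] -/
theorem abs_bdgEnergyTanh_density_two_grid_le (L L' : ℕ) [NeZero L] [NeZero L'] (β μ' h : ℝ) :
    |(∑ k : TorusSite 2 L,
        Real.sqrt ((torusBand L k - μ') ^ 2 + (2 * Real.sqrt 2 * h * dWaveGap k) ^ 2) *
          Real.tanh (β * Real.sqrt ((torusBand L k - μ') ^ 2 + (2 * Real.sqrt 2 * h * dWaveGap k) ^ 2) / 2)) /
        (L : ℝ) ^ 2 -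
      (∑ k : TorusSite 2 L',
        Real.sqrt ((torusBand L' k - μ') ^ 2 + (2 * Real.sqrt 2 * h * dWaveGap k) ^ 2) *
          Real.tanh (β * Real.sqrt ((torusBand L' k - μ') ^ 2 + (2 * Real.sqrt 2 * h * dWaveGap k) ^ 2) / 2)) /
        (L' : ℝ) ^ 2| ≤
      2 * π * (3 / 2 * (2 + 2 * Real.sqrt 2 * |h|)) * (1 / (L : ℝ) + 1 / (L' : ℝ)) := by
  have hL : (0 : ℝ) < L := Nat.cast_pos.2 (Nat.pos_of_ne_zero (NeZero.ne L))
  have hL' : (0 : ℝ) < L' := Nat.cast_pos.2 (Nat.pos_of_ne_zero (NeZero.ne L'))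
  have h1 := abs_sum_bdgEnergyTanh_sub_integral_le L β μ' h
  have h2 := abs_sum_bdgEnergyTanh_sub_integral_le L' β μ' h
  set K := 2 * π * (3 / 2 * (2 + 2 * Real.sqrt 2 * |h|)) with hKdef
  have hK0 : 0 ≤ K := by rw [hKdef]; positivity
  set I := ∫ y in (-π)..π, ∫ x in (-π)..π,
        Real.sqrt ((-2 * (Real.cos x + Real.cos y) - μ') ^ 2 + (2 * Real.sqrt 2 * h * (Real.cos x - Real.cos y)) ^ 2) *
          Real.tanh (β * Real.sqrt ((-2 * (Real.cos x + Real.cos y) - μ') ^ 2 +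
            (2 * Real.sqrt 2 * h * (Real.cos x - Real.cos y)) ^ 2) / 2) with hI
  set S := ∑ k : TorusSite 2 L,
        Real.sqrt ((torusBand L k - μ') ^ 2 + (2 * Real.sqrt 2 * h * dWaveGap k) ^ 2) *
          Real.tanh (β * Real.sqrt ((torusBand L k - μ') ^ 2 + (2 * Real.sqrt 2 * h * dWaveGap k) ^ 2) / 2) with hS
  set S' := ∑ k : TorusSite 2 L',
        Real.sqrt ((torusBand L' k - μ') ^ 2 + (2 * Real.sqrt 2 * h * dWaveGap k) ^ 2) *
          Real.tanh (β * Real.sqrt ((torusBand L' k - μ') ^ 2 + (2 * Real.sqrt 2 * h * dWaveGap k) ^ 2) / 2) with hS'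
  -- per-site forms of the two bounds
  have h1' : |S / (L : ℝ) ^ 2 - I / (4 * π ^ 2)| ≤ K * (1 / (L : ℝ)) := by
    have hL2 : (0 : ℝ) < (L : ℝ) ^ 2 := by positivity
    have e : S / (L : ℝ) ^ 2 - I / (4 * π ^ 2) = (S - (L : ℝ) ^ 2 / (4 * π ^ 2) * I) / (L : ℝ) ^ 2 := by
      field_simp
    rw [e, abs_div, abs_of_pos hL2, div_le_iff₀ hL2]
    calc |S - (L : ℝ) ^ 2 / (4 * π ^ 2) * I| ≤ K * L := h1
      _ = K * (1 / (L : ℝ)) * (L : ℝ) ^ 2 := by field_simp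
  have h2' : |S' / (L' : ℝ) ^ 2 - I / (4 * π ^ 2)| ≤ K * (1 / (L' : ℝ)) := by
    have hL2 : (0 : ℝ) < (L' : ℝ) ^ 2 := by positivity
    have e : S' / (L' : ℝ) ^ 2 - I / (4 * π ^ 2) = (S' - (L' : ℝ) ^ 2 / (4 * π ^ 2) * I) / (L' : ℝ) ^ 2 := by
      field_simp
    rw [e, abs_div, abs_of_pos hL2, div_le_iff₀ hL2]
    calc |S' - (L' : ℝ) ^ 2 / (4 * π ^ 2) * I| ≤ K * L' := h2
      _ = K * (1 / (L' : ℝ)) * (L' : ℝ) ^ 2 := by field_simp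
  have e3 : S / (L : ℝ) ^ 2 - S' / (L' : ℝ) ^ 2 =
      (S / (L : ℝ) ^ 2 - I / (4 * π ^ 2)) - (S' / (L' : ℝ) ^ 2 - I / (4 * π ^ 2)) := by ring
  rw [e3]
  refine (abs_sub _ _).trans ?_
  rw [mul_add]
  exact add_le_add h1' h2'

end Summit.Ventures.CertifiedManyBodySolver.Observables

end
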